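import Mathlib
import Summits.NavierStokesRegularity.NavierStokesRegularity.Theorems.EulerZoomLiouvillePowerGaugeEulerLiouvilleHoopAxisRadialLaw
import Summits.NavierStokesRegularity.NavierStokesRegularity.Theorems.EulerZoomLiouvillePowerGaugeEulerLiouvilleHoopAxisAtom

/-!
# Hoop core — AX-3 bridge: the circle-averaged radial law (AX-2) in chart form, term by term

Sub-problem `NavierStokesRegularity`, crux `PowerGaugeEulerLiouville` (a crux CLASS of self-similar Euler/NS strata on the
MODEL lattice — not NS regularity, not E).  K-AXIS plate AX-3 (LEAD 19832 ns-typeII-p2 g14; seat ns-ezl-w3 g7).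

The LEAD's AX-2 `HoopCore.radialLaw_circleAvg` (`…HoopAxisRadialLaw`, p689831) states, for a `C²` self-similar Euler profile pair
`IsSelfSimilarEulerProfile γ c V P` and every circle `axisPt s t ·` (`t > 0`), that the circle average of ONE six-term integrand
vanishes.  Here that integrand is rewritten pointwise in the smooth frame `f₀ = R_θ e₀`, `f₁ = R_θ e₁` (`A = ⟪V, f₀⟫`, `B = ⟪V, f₁⟫`,
`C = V_z`, all at `axisPt s t θ`) and the average is SPLIT into the six averages the `t`-integration (AX-3) manipulates separately:

`radialLaw_chart`:  `circleAvg ⟪∇P, ê_r⟫ s t + (2π)⁻¹∫[γA + (γt + 2A)⟪DVf₀,f₀⟫] + (2π)⁻¹∫[(γ + ⟪DVe_z,e_z⟫)A + (γ(s − c₂) + C)⟪DVe_z,f₀⟫]`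
`  − γ·(2π)⁻¹∫[−(c₀cos θ + c₁sin θ)⟪DVe_z,e_z⟫] + (1 − 3γ)·(2π)⁻¹∫A + ((2π)⁻¹∫(A² − B²))/t = 0`,

i.e. `∂_t⟨P⟩ + ∂_t⟨(γr + V_r)V_r⟩ + ∂_σ⟨(γ(y₂ − c₂) + V_z)V_r⟩ − γ∂_σ⟨−(c₀ê_r⁰ + c₁ê_r¹)V_z⟩ + (1 − 3γ)⟨V_r⟩ + ⟨V_r² − V_θ²⟩/t = 0` with
every term an explicit chart integral (`…HoopAxisAtom.hasDerivAt_chartAvg_lateral`, `…HoopAxisEndTerm`).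
WHAT THIS IS NOT: not NS, not E — bookkeeping; 19832 OPEN; NS regularity NOT proved.  [folklore]
-/

noncomputable section

open MeasureTheory Set WithLp Metric Real Function Filter Topology intervalIntegral
open scoped InnerProductSpace RealInnerProductSpace

set_option linter.dupNamespace false

namespace Summit.NavierStokesRegularity.NavierStokesRegularity.Theorems.PowerGaugeEulerLiouville.HoopCore

open Literature.Analysis Literature.Analysis.FluidPDE

variable {V : EuclideanSpace ℝ (Fin 3) → EuclideanSpace ℝ (Fin 3)}

/-! ## §0 Restricting jointly continuous chart functions to one variable

Stated with an ABSTRACT function argument on purpose: restricting by `.comp` against a concrete integrand makes the unifier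
delta-unfold `inner`/`axisPt` (the `…HoopCircleAvgCalculus` warning); with the function abstract the instance is a `β`-reduction. -/

/-- Restriction of a jointly continuous `h : ℝ → ℝ → ℝ` (given as `uncurry h`) to the second variable. [folklore] -/
theorem continuous_of_uncurry_left {h : ℝ → ℝ → ℝ} (hh : Continuous (uncurry h)) (a : ℝ) : Continuous fun b : ℝ => h a b :=
  hh.comp (continuous_const.prodMk continuous_id)

/-- Restriction of a jointly continuous `h : ℝ → ℝ → ℝ` (given as `uncurry h`) to the first variable. [folklore] -/
theorem continuous_of_uncurry_right {h : ℝ → ℝ → ℝ} (hh : Continuous (uncurry h)) (b : ℝ) : Continuous fun a : ℝ => h a b :=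
  hh.comp (continuous_id.prodMk continuous_const)

/-- Restriction of a jointly continuous `F : ℝ × ℝ × ℝ → ℝ` to the circle variable: `θ ↦ F (σ, t, θ)`. [folklore] -/
theorem continuous_along_angle {F : ℝ × ℝ × ℝ → ℝ} (hF : Continuous F) (σ t : ℝ) : Continuous fun θ : ℝ => F (σ, t, θ) :=
  hF.comp (continuous_const.prodMk (continuous_const.prodMk continuous_id))

/-! ## §1 The three flux derivatives and the hoop quotient in the smooth frame (`t > 0`) -/

/-- **Lateral flux derivative, chart form** (`t > 0`, `y = axisPt s t θ`, `A = ⟪V(y), R_θe₀⟫`):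
`D[(γr + V_r)V_r](y)[ê_r] = γA + (γt + 2A)⟪DV(y) R_θe₀, R_θe₀⟫`. [folklore] -/
theorem fderiv_radialFlux_eR_chart (γ s : ℝ) {t : ℝ} (ht : 0 < t) (θ : ℝ) (hV : DifferentiableAt ℝ V (axisPt s t θ)) :
    fderiv ℝ (fun y => (γ * cylRadius y + radialVelocity V y) * radialVelocity V y) (axisPt s t θ) (eR (axisPt s t θ)) =
      γ * ⟪V (axisPt s t θ), rotZ θ (EuclideanSpace.single (0 : Fin 3) (1 : ℝ))⟫ +
        (γ * t + 2 * ⟪V (axisPt s t θ), rotZ θ (EuclideanSpace.single (0 : Fin 3) (1 : ℝ))⟫) *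
          ⟪fderiv ℝ V (axisPt s t θ) (rotZ θ (EuclideanSpace.single (0 : Fin 3) (1 : ℝ))),
            rotZ θ (EuclideanSpace.single (0 : Fin 3) (1 : ℝ))⟫ := by
  rw [fderiv_radialFlux_eR s ht θ hV, radialVelocity, eR_axisPt s ht θ]
  ring

/-- **Axial flux derivative, chart form** (`t > 0`):
`D[(γ(y₂ − c₂) + V_z)V_r](y)[e_z] = (γ + ⟪DV e_z, e_z⟫)A + (γ(s − c₂) + V_z)⟪DV e_z, R_θe₀⟫`. [folklore] -/
theorem fderiv_axialFlux_eZ_chart (γ : ℝ) (c : EuclideanSpace ℝ (Fin 3)) (s : ℝ) {t : ℝ} (ht : 0 < t) (θ : ℝ)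
    (hV : DifferentiableAt ℝ V (axisPt s t θ)) :
    fderiv ℝ (fun y => (γ * (y 2 - c 2) + axialVelocity V y) * radialVelocity V y) (axisPt s t θ) eZ =
      (γ + ⟪fderiv ℝ V (axisPt s t θ) eZ, eZ⟫) * ⟪V (axisPt s t θ), rotZ θ (EuclideanSpace.single (0 : Fin 3) (1 : ℝ))⟫ +
        (γ * (s - c 2) + axialVelocity V (axisPt s t θ)) *
          ⟪fderiv ℝ V (axisPt s t θ) eZ, rotZ θ (EuclideanSpace.single (0 : Fin 3) (1 : ℝ))⟫ := by
  rw [fderiv_axialFlux_eZ s ht θ hV, radialVelocity, eR_axisPt s ht θ]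

/-- **Offset flux derivative, chart form** (`t > 0`):
`D[−(c₀ê_r⁰ + c₁ê_r¹)V_z](y)[e_z] = −(c₀ cos θ + c₁ sin θ)⟪DV e_z, e_z⟫`. [folklore] -/
theorem fderiv_offsetFlux_eZ_chart (c : EuclideanSpace ℝ (Fin 3)) (s : ℝ) {t : ℝ} (ht : 0 < t) (θ : ℝ)
    (hV : DifferentiableAt ℝ V (axisPt s t θ)) :
    fderiv ℝ (fun y => (-(c 0 * eR y 0 + c 1 * eR y 1)) * axialVelocity V y) (axisPt s t θ) eZ =
      (-(c 0 * Real.cos θ + c 1 * Real.sin θ)) * ⟪fderiv ℝ V (axisPt s t θ) eZ, eZ⟫ := by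
  rw [fderiv_offsetFlux_eZ s ht θ hV, inner_eR_axisPt c s ht θ]

/-- **Hoop quotient, chart form** (`t > 0`): `(V_r² − V_θ²)(y)/r(y) = (A² − B²)/t`. [folklore] -/
theorem hoopQuot_chart (V : EuclideanSpace ℝ (Fin 3) → EuclideanSpace ℝ (Fin 3)) (s : ℝ) {t : ℝ} (ht : 0 < t) (θ : ℝ) :
    (radialVelocity V (axisPt s t θ) ^ 2 - swirlVelocity V (axisPt s t θ) ^ 2) / cylRadius (axisPt s t θ) =
      (⟪V (axisPt s t θ), rotZ θ (EuclideanSpace.single (0 : Fin 3) (1 : ℝ))⟫ ^ 2 -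
          ⟪V (axisPt s t θ), rotZ θ (EuclideanSpace.single (1 : Fin 3) (1 : ℝ))⟫ ^ 2) / t := by
  rw [cylRadius_axisPt s ht.le θ, inner_rotZ_single_zero_eq_radialVelocity V s ht θ,
    inner_rotZ_single_one_eq_swirlVelocity V s ht θ]

/-- The pressure-gradient integrand `θ ↦ ⟪∇P(axisPt s t θ), ê_r(axisPt s t θ)⟫` is continuous along the circle (`P ∈ C¹`, `t > 0`).
[folklore] -/
theorem continuous_inner_gradient_eR_axisPt {P : EuclideanSpace ℝ (Fin 3) → ℝ} (hP : ContDiff ℝ 1 P) (s : ℝ) {t : ℝ}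
    (ht : 0 < t) : Continuous fun θ : ℝ => ⟪gradient P (axisPt s t θ), eR (axisPt s t θ)⟫ := by
  have hg : Continuous (gradient P) := by
    have e : gradient P = fun y => (InnerProductSpace.toDual ℝ (EuclideanSpace ℝ (Fin 3))).symm (fderiv ℝ P y) := rfl
    rw [e]
    exact (InnerProductSpace.toDual ℝ (EuclideanSpace ℝ (Fin 3))).symm.continuous.comp (hP.continuous_fderiv one_ne_zero)
  exact (hg.comp (continuous_axisPt_angle s t)).inner (continuous_eR_axisPt s ht)

/-! ## §2 AX-2 in chart form, split term by term -/

/-- **THE CIRCLE-AVERAGED RADIAL LAW IN CHART FORM, SPLIT** (`IsSelfSimilarEulerProfile γ c V P`, `t > 0`; `A = ⟪V, R_θe₀⟫`,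
`B = ⟪V, R_θe₁⟫`, `C = V_z` at `axisPt s t θ`):
`circleAvg ⟪∇P, ê_r⟫ s t + (2π)⁻¹∫₀^{2π}[γA + (γt + 2A)⟪DVf₀,f₀⟫]dθ + (2π)⁻¹∫₀^{2π}[(γ + ⟪DVe_z,e_z⟫)A + (γ(s − c₂) + C)⟪DVe_z,f₀⟫]dθ`
`− γ·(2π)⁻¹∫₀^{2π}[−(c₀cos θ + c₁sin θ)⟪DVe_z,e_z⟫]dθ + (1 − 3γ)·(2π)⁻¹∫₀^{2π}A dθ + ((2π)⁻¹∫₀^{2π}(A² − B²)dθ)/t = 0`.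
This is `radialLaw_circleAvg` with every term the explicit chart integral that `…HoopAxisAtom` / `…HoopAxisEndTerm` differentiate.
[folklore] -/
theorem radialLaw_chart {γ : ℝ} {c : EuclideanSpace ℝ (Fin 3)} {P : EuclideanSpace ℝ (Fin 3) → ℝ}
    (hprof : IsSelfSimilarEulerProfile γ c V P) (s : ℝ) {t : ℝ} (ht : 0 < t) :
    circleAvg (fun y => ⟪gradient P y, eR y⟫) s t +
      1 / (2 * Real.pi) * (∫ θ in (0 : ℝ)..2 * Real.pi,
        (γ * ⟪V (axisPt s t θ), rotZ θ (EuclideanSpace.single (0 : Fin 3) (1 : ℝ))⟫ +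
          (γ * t + 2 * ⟪V (axisPt s t θ), rotZ θ (EuclideanSpace.single (0 : Fin 3) (1 : ℝ))⟫) *
            ⟪fderiv ℝ V (axisPt s t θ) (rotZ θ (EuclideanSpace.single (0 : Fin 3) (1 : ℝ))),
              rotZ θ (EuclideanSpace.single (0 : Fin 3) (1 : ℝ))⟫)) +
      1 / (2 * Real.pi) * (∫ θ in (0 : ℝ)..2 * Real.pi,
        ((γ + ⟪fderiv ℝ V (axisPt s t θ) eZ, eZ⟫) * ⟪V (axisPt s t θ), rotZ θ (EuclideanSpace.single (0 : Fin 3) (1 : ℝ))⟫ +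
          (γ * (s - c 2) + axialVelocity V (axisPt s t θ)) *
            ⟪fderiv ℝ V (axisPt s t θ) eZ, rotZ θ (EuclideanSpace.single (0 : Fin 3) (1 : ℝ))⟫)) -
      γ * (1 / (2 * Real.pi) * ∫ θ in (0 : ℝ)..2 * Real.pi,
        (-(c 0 * Real.cos θ + c 1 * Real.sin θ)) * ⟪fderiv ℝ V (axisPt s t θ) eZ, eZ⟫) +
      (1 - 3 * γ) * (1 / (2 * Real.pi) * ∫ θ in (0 : ℝ)..2 * Real.pi,
        ⟪V (axisPt s t θ), rotZ θ (EuclideanSpace.single (0 : Fin 3) (1 : ℝ))⟫) +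
      (1 / (2 * Real.pi) * ∫ θ in (0 : ℝ)..2 * Real.pi,
        (⟪V (axisPt s t θ), rotZ θ (EuclideanSpace.single (0 : Fin 3) (1 : ℝ))⟫ ^ 2 -
          ⟪V (axisPt s t θ), rotZ θ (EuclideanSpace.single (1 : Fin 3) (1 : ℝ))⟫ ^ 2)) / t = 0 := by
  have hV1 : ContDiff ℝ 1 V := hprof.contDiff_velocity.of_le (by norm_num)
  have hVc : Continuous V := hprof.contDiff_velocity.continuous
  have hVd : ∀ θ, DifferentiableAt ℝ V (axisPt s t θ) := fun θ => (hprof.contDiff_velocity.differentiable (by norm_num)) _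
  -- the AX-2 integrand, pointwise, in chart form (same order of terms)
  have hpt : ∀ θ, ⟪gradient P (axisPt s t θ), eR (axisPt s t θ)⟫ + (1 - 3 * γ) * radialVelocity V (axisPt s t θ) +
      fderiv ℝ (fun y => (γ * cylRadius y + radialVelocity V y) * radialVelocity V y) (axisPt s t θ) (eR (axisPt s t θ)) +
      fderiv ℝ (fun y => (γ * (y 2 - c 2) + axialVelocity V y) * radialVelocity V y) (axisPt s t θ) eZ -
      γ * fderiv ℝ (fun y => (-(c 0 * eR y 0 + c 1 * eR y 1)) * axialVelocity V y) (axisPt s t θ) eZ +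
      (radialVelocity V (axisPt s t θ) ^ 2 - swirlVelocity V (axisPt s t θ) ^ 2) / cylRadius (axisPt s t θ) =
        ⟪gradient P (axisPt s t θ), eR (axisPt s t θ)⟫ + (1 - 3 * γ) * ⟪V (axisPt s t θ), rotZ θ (EuclideanSpace.single (0 : Fin 3) (1 : ℝ))⟫ +
        (γ * ⟪V (axisPt s t θ), rotZ θ (EuclideanSpace.single (0 : Fin 3) (1 : ℝ))⟫ +
          (γ * t + 2 * ⟪V (axisPt s t θ), rotZ θ (EuclideanSpace.single (0 : Fin 3) (1 : ℝ))⟫) *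
            ⟪fderiv ℝ V (axisPt s t θ) (rotZ θ (EuclideanSpace.single (0 : Fin 3) (1 : ℝ))), rotZ θ (EuclideanSpace.single (0 : Fin 3) (1 : ℝ))⟫) +
        ((γ + ⟪fderiv ℝ V (axisPt s t θ) eZ, eZ⟫) * ⟪V (axisPt s t θ), rotZ θ (EuclideanSpace.single (0 : Fin 3) (1 : ℝ))⟫ +
          (γ * (s - c 2) + axialVelocity V (axisPt s t θ)) *
            ⟪fderiv ℝ V (axisPt s t θ) eZ, rotZ θ (EuclideanSpace.single (0 : Fin 3) (1 : ℝ))⟫) -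
        γ * ((-(c 0 * Real.cos θ + c 1 * Real.sin θ)) * ⟪fderiv ℝ V (axisPt s t θ) eZ, eZ⟫) +
        (⟪V (axisPt s t θ), rotZ θ (EuclideanSpace.single (0 : Fin 3) (1 : ℝ))⟫ ^ 2 -
          ⟪V (axisPt s t θ), rotZ θ (EuclideanSpace.single (1 : Fin 3) (1 : ℝ))⟫ ^ 2) / t := by
    intro θ
    rw [fderiv_radialFlux_eR_chart γ s ht θ (hVd θ), fderiv_axialFlux_eZ_chart γ c s ht θ (hVd θ),
      fderiv_offsetFlux_eZ_chart c s ht θ (hVd θ), hoopQuot_chart V s ht θ, ← inner_rotZ_single_zero_eq_radialVelocity V s ht θ]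
  -- continuity (hence interval integrability) of the six integrands
  have hcA : Continuous fun θ : ℝ => ⟪V (axisPt s t θ), rotZ θ (EuclideanSpace.single (0 : Fin 3) (1 : ℝ))⟫ :=
    continuous_along_angle (continuous_sliceA hVc) s t
  have hcB : Continuous fun θ : ℝ => ⟪V (axisPt s t θ), rotZ θ (EuclideanSpace.single (1 : Fin 3) (1 : ℝ))⟫ :=
    continuous_along_angle (continuous_sliceB hVc) s t
  have hc00 : Continuous fun θ : ℝ => ⟪fderiv ℝ V (axisPt s t θ) (rotZ θ (EuclideanSpace.single (0 : Fin 3) (1 : ℝ))), rotZ θ (EuclideanSpace.single (0 : Fin 3) (1 : ℝ))⟫ :=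
    continuous_along_angle (continuous_sliceEntry hV1 continuous_rotZ_single_zero continuous_rotZ_single_zero) s t
  have hcZZ : Continuous fun θ : ℝ => ⟪fderiv ℝ V (axisPt s t θ) eZ, eZ⟫ :=
    continuous_along_angle (continuous_sliceEntry hV1 (u := fun _ => eZ) (w := fun _ => eZ) continuous_const continuous_const) s t
  have hcZ0 : Continuous fun θ : ℝ => ⟪fderiv ℝ V (axisPt s t θ) eZ, rotZ θ (EuclideanSpace.single (0 : Fin 3) (1 : ℝ))⟫ :=
    continuous_along_angle (continuous_sliceEntry hV1 (u := fun _ => eZ) (w := fun θ => rotZ θ (EuclideanSpace.single (0 : Fin 3) (1 : ℝ)))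
      continuous_const continuous_rotZ_single_zero) s t
  have hcC : Continuous fun θ : ℝ => axialVelocity V (axisPt s t θ) := continuous_along_angle (continuous_sliceC hVc) s t
  have ip : IntervalIntegrable (fun θ : ℝ => ⟪gradient P (axisPt s t θ), eR (axisPt s t θ)⟫) volume 0 (2 * Real.pi) :=
    (continuous_inner_gradient_eR_axisPt hprof.contDiff_pressure s ht).intervalIntegrable _ _
  have iA : IntervalIntegrable (fun θ : ℝ => (1 - 3 * γ) * ⟪V (axisPt s t θ), rotZ θ (EuclideanSpace.single (0 : Fin 3) (1 : ℝ))⟫) volume 0 (2 * Real.pi) :=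
    (continuous_const.mul hcA).intervalIntegrable _ _
  have iL : IntervalIntegrable (fun θ : ℝ =>
      (γ * ⟪V (axisPt s t θ), rotZ θ (EuclideanSpace.single (0 : Fin 3) (1 : ℝ))⟫ +
          (γ * t + 2 * ⟪V (axisPt s t θ), rotZ θ (EuclideanSpace.single (0 : Fin 3) (1 : ℝ))⟫) *
            ⟪fderiv ℝ V (axisPt s t θ) (rotZ θ (EuclideanSpace.single (0 : Fin 3) (1 : ℝ))), rotZ θ (EuclideanSpace.single (0 : Fin 3) (1 : ℝ))⟫)) volume 0 (2 * Real.pi) :=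
    ((continuous_const.mul hcA).add (((continuous_const.mul continuous_const).add (continuous_const.mul hcA)).mul hc00)).intervalIntegrable _ _
  have iE : IntervalIntegrable (fun θ : ℝ =>
      ((γ + ⟪fderiv ℝ V (axisPt s t θ) eZ, eZ⟫) * ⟪V (axisPt s t θ), rotZ θ (EuclideanSpace.single (0 : Fin 3) (1 : ℝ))⟫ +
          (γ * (s - c 2) + axialVelocity V (axisPt s t θ)) *
            ⟪fderiv ℝ V (axisPt s t θ) eZ, rotZ θ (EuclideanSpace.single (0 : Fin 3) (1 : ℝ))⟫)) volume 0 (2 * Real.pi) :=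
    (((continuous_const.add hcZZ).mul hcA).add (((continuous_const.mul continuous_const).add hcC).mul hcZ0)).intervalIntegrable _ _
  have iO : IntervalIntegrable (fun θ : ℝ => γ * ((-(c 0 * Real.cos θ + c 1 * Real.sin θ)) * ⟪fderiv ℝ V (axisPt s t θ) eZ, eZ⟫)) volume 0 (2 * Real.pi) :=
    (continuous_const.mul ((by fun_prop : Continuous fun θ : ℝ => (-(c 0 * Real.cos θ + c 1 * Real.sin θ))).mul hcZZ)).intervalIntegrable _ _
  have iH : IntervalIntegrable (fun θ : ℝ =>
      (⟪V (axisPt s t θ), rotZ θ (EuclideanSpace.single (0 : Fin 3) (1 : ℝ))⟫ ^ 2 -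
          ⟪V (axisPt s t θ), rotZ θ (EuclideanSpace.single (1 : Fin 3) (1 : ℝ))⟫ ^ 2) / t) volume 0 (2 * Real.pi) :=
    (((hcA.pow 2).sub (hcB.pow 2)).div_const t).intervalIntegrable _ _
  -- the AX-2 identity, with the integrand rewritten and the integral split
  have hAV := radialLaw_circleAvg hprof s ht
  unfold circleAvg at hAV
  rw [intervalIntegral.integral_congr (fun θ _ => hpt θ),
    intervalIntegral.integral_add ((((ip.add iA).add iL).add iE).sub iO) iH,
    intervalIntegral.integral_sub (((ip.add iA).add iL).add iE) iO,
    intervalIntegral.integral_add ((ip.add iA).add iL) iE, intervalIntegral.integral_add (ip.add iA) iL,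
    intervalIntegral.integral_add ip iA, intervalIntegral.integral_const_mul, intervalIntegral.integral_const_mul,
    intervalIntegral.integral_div] at hAV
  unfold circleAvg
  -- the six integrals are now atoms
  generalize (∫ θ in (0 : ℝ)..2 * Real.pi, ⟪gradient P (axisPt s t θ), eR (axisPt s t θ)⟫) = Ip at hAV ⊢
  generalize (∫ θ in (0 : ℝ)..2 * Real.pi, ⟪V (axisPt s t θ), rotZ θ (EuclideanSpace.single (0 : Fin 3) (1 : ℝ))⟫) = IA at hAV ⊢
  generalize (∫ θ in (0 : ℝ)..2 * Real.pi,
        (γ * ⟪V (axisPt s t θ), rotZ θ (EuclideanSpace.single (0 : Fin 3) (1 : ℝ))⟫ +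
          (γ * t + 2 * ⟪V (axisPt s t θ), rotZ θ (EuclideanSpace.single (0 : Fin 3) (1 : ℝ))⟫) *
            ⟪fderiv ℝ V (axisPt s t θ) (rotZ θ (EuclideanSpace.single (0 : Fin 3) (1 : ℝ))), rotZ θ (EuclideanSpace.single (0 : Fin 3) (1 : ℝ))⟫)) = IL at hAV ⊢
  generalize (∫ θ in (0 : ℝ)..2 * Real.pi,
        ((γ + ⟪fderiv ℝ V (axisPt s t θ) eZ, eZ⟫) * ⟪V (axisPt s t θ), rotZ θ (EuclideanSpace.single (0 : Fin 3) (1 : ℝ))⟫ +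
          (γ * (s - c 2) + axialVelocity V (axisPt s t θ)) *
            ⟪fderiv ℝ V (axisPt s t θ) eZ, rotZ θ (EuclideanSpace.single (0 : Fin 3) (1 : ℝ))⟫)) = IE at hAV ⊢
  generalize (∫ θ in (0 : ℝ)..2 * Real.pi, ((-(c 0 * Real.cos θ + c 1 * Real.sin θ)) * ⟪fderiv ℝ V (axisPt s t θ) eZ, eZ⟫)) = IO at hAV ⊢
  generalize (∫ θ in (0 : ℝ)..2 * Real.pi,
        (⟪V (axisPt s t θ), rotZ θ (EuclideanSpace.single (0 : Fin 3) (1 : ℝ))⟫ ^ 2 -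
          ⟪V (axisPt s t θ), rotZ θ (EuclideanSpace.single (1 : Fin 3) (1 : ℝ))⟫ ^ 2)) = IH at hAV ⊢
  linear_combination hAV

end Summit.NavierStokesRegularity.NavierStokesRegularity.Theorems.PowerGaugeEulerLiouville.HoopCore

end
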